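import Summits.BirchSwinnertonDyer.BirchSwinnertonDyer.Theorems.GoldfeldAllTwistsTwoConverseTwinAdditiveTwoPrimesTwistSelmerDualLemma
import Summits.BirchSwinnertonDyer.BirchSwinnertonDyer.Theorems.GoldfeldAllTwistsTwoConverseTwinAdditiveTwoPrimesTwistSelmerDualTwoAdic
import HarnessLib

set_option linter.dupNamespace false -- namespace `…BirchSwinnertonDyer.BirchSwinnertonDyer…` is the cell's (D-0017 nested layout)
set_option autoImplicit false

/-!
# Twin″ (item 19140), LINE B⁗ T3-D part 3b: `#S′ ≤ 4` for the dual Selmer set `S′ = S(84qp, −28q²p²)` of `49a1^{(−2qp)}` on family C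

Cell `bsd-goldfeld`, seat `bsd-goldfeld-s1p-c3x` (gen 10); planner ORDER (cccxvii) «LINE B⁗ — TRANCHE 3», object T3-D (= N3).
`--supports stmt-BirchSwinnertonDyer-19140` as a HELPER. FACT-FREE (no fact binder, no definition, no `sorry`).
Family C: `q ≡ 3 (4)` prime, `(q/7) = −1`; `p ≡ 5 (8)` prime, `(−7/p) = +1`; `(p/q) = −1`; `hcell : q ≡ 7 (8) ∨ β` (`β`: `x⁴ = −7` mod `p`).
KILL TABLE (memo `ROUTE-S1PLUS/b4-c3xg10/T3D-DESCENT-KILLTABLE.md`) for the 32 signed squarefree `d ∣ 14qp`: at `7` (`7 ∥ disc`):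
`−1, −2, −p, −2p, q, 2q, qp, 2qp` (`(d/7) = −1`) and `7, 14, 7p, 14p, −7q, −14q, −7qp, −14qp` (`(d′/7) = −1`); at `p`: `2, −14, −q, 7q`;
at `2` (part 3b-1): `p, −7p, −2qp, 14qp`; the split classes `−qp, 7qp, 2p, −14p`: at `2` when `q ≡ 7 (8)`, at `p` under β (part 3a).
Survivors `⊆ {1, −7, −2q, 14q}`. §1: `p ∤ d` for `d ∈ S′`; §2: `#S′ ≤ 4`. HONEST FRAMING: no `BSD(W,2)` is proved; BSD is not proved by this.

References: [SilvermanAEC2009] Prop. X.4.9, Example X.4.10; [Zywina2025] Lemma 3.1 (proof).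
-/


noncomputable section

open scoped Classical

open Literature.NumberTheory.EllipticCurves
open Literature.NumberTheory.EllipticCurves.Zywina2025 (isSquare_zmod_of_isSoluble_padic)

namespace Summit.BirchSwinnertonDyer.BirchSwinnertonDyer.Theorems.GoldfeldGoodTwists

section SelmerDual
variable {q p : ℕ} [Fact q.Prime] [Fact p.Prime]

/-- A natural number not divisible by the prime `ℓ` is non-zero in `ZMod ℓ`, as an integer cast. [folklore] -/
private theorem intCast_ne_zero_of_not_dvd' {l : ℕ} [Fact l.Prime] {n : ℕ} (h : ¬ l ∣ n) : ((n : ℤ) : ZMod l) ≠ 0 := by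
  rw [Int.cast_natCast, Ne, ZMod.natCast_eq_zero_iff]; exact h

/-- `ℓ ∤ 2^a · 7^b` for a prime `ℓ ∉ {2, 7}`. [folklore] -/
private theorem not_dvd_two_pow_mul_seven_pow' {l : ℕ} (hl : l.Prime) (hl2 : l ≠ 2) (hl7 : l ≠ 7) (a b : ℕ) :
    ¬ l ∣ 2 ^ a * 7 ^ b := by
  intro h
  rcases (Nat.Prime.dvd_mul hl).mp h with h | h
  · exact hl2 ((Nat.prime_dvd_prime_iff_eq hl Nat.prime_two).mp (hl.dvd_of_dvd_pow h))
  · exact hl7 ((Nat.prime_dvd_prime_iff_eq hl (by norm_num)).mp (hl.dvd_of_dvd_pow h))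

/-- `7 ∤ a`, `7 ∤ b` ⇒ `7 ∤ ab`. [folklore] -/
private theorem not_seven_dvd_mul {a b : ℤ} (ha : ¬ (7 : ℤ) ∣ a) (hb : ¬ (7 : ℤ) ∣ b) : ¬ (7 : ℤ) ∣ a * b := fun h ↦
  ((Int.prime_iff_natAbs_prime.mpr (by norm_num) : Prime (7 : ℤ)).dvd_or_dvd h).elim ha hb

omit [Fact q.Prime] [Fact p.Prime] in
/-- **The `7`-adic kill** for `S′ = S(84qp, −28q²p²)`, `7 ∤ qp`: the discriminant `(84qp)² + 112q²p² = 7·1024·q²p²` is exactly divisible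
by `7`, so a class `d` with `7 ∤ d` and `(d/7) = −1` has no `ℚ₇`-point. [cite: Zywina2025, Lemma 3.1 (proof)] -/
theorem not_isSoluble_seven_dual (h7qp : ¬ 7 ∣ q * p) {x y : ℤ} (hxy : x * y = -28 * ((q : ℤ) * p) ^ 2)
    (hx : ¬ (7 : ℤ) ∣ x) (hleg : legendreSym 7 x = -1) :
    ¬ ((twoIsogenyQuartic (84 * ((q : ℤ) * p)) x y).map (Int.castRingHom ℚ_[7])).IsSoluble := by
  haveI : Fact (Nat.Prime 7) := ⟨by norm_num⟩
  intro hsol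
  have e1 : (84 * ((q : ℤ) * p)) ^ 2 - 4 * x * y = 7168 * ((q * p : ℕ) : ℤ) ^ 2 := by
    push_cast; linear_combination (-4 : ℤ) * hxy
  have hB1 : (7 : ℤ) ∣ (84 * ((q : ℤ) * p)) ^ 2 - 4 * x * y := by rw [e1]; exact ⟨1024 * ((q * p : ℕ) : ℤ) ^ 2, by ring⟩
  have hB2 : ¬ (7 : ℤ) ^ 2 ∣ (84 * ((q : ℤ) * p)) ^ 2 - 4 * x * y := by rw [e1]; exact not_sq_seven_dvd_of_not_dvd' h7qp
  exact (legendreSym.eq_neg_one_iff 7).mp hleg (isSquare_zmod_of_isSoluble_padic (p := 7) (by norm_num) hx hB1 hB2 hsol).2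

omit [Fact q.Prime] [Fact p.Prime] in
/-- The same with the roles of `d, d′` exchanged (classes `7 ∣ d`: test `d′`). [cite: Zywina2025, Lemma 3.1 (proof)] -/
theorem not_isSoluble_seven_dual' (h7qp : ¬ 7 ∣ q * p) {x y : ℤ} (hxy : x * y = -28 * ((q : ℤ) * p) ^ 2)
    (hy : ¬ (7 : ℤ) ∣ y) (hleg : legendreSym 7 y = -1) :
    ¬ ((twoIsogenyQuartic (84 * ((q : ℤ) * p)) x y).map (Int.castRingHom ℚ_[7])).IsSoluble := fun hsol ↦
  not_isSoluble_seven_dual h7qp (by rw [mul_comm]; exact hxy) hy hleg ((isSoluble_map_twoIsogenyQuartic_comm _ _ _ _).mp hsol)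

omit [Fact q.Prime] in
/-- **The type-β kill at `p`, dual side**: a class `d = p·e₀` of `S′` with cofactor `d′ = p·e′₀`, `e′₀e₀ = −28q²`, `p ∤ e′₀`, and `−2q e′₀` a
non-square mod `p` has no `ℚ_p`-point, granted `x⁴ = −7` and `u² = 7` mod `p` (part 1 §1 + part 3a). [cite: SilvermanAEC2009, Example X.4.10] -/
theorem not_isSoluble_padic_typeBeta_class_dual (h448 : (448 : ZMod p) ≠ 0) {x u : ZMod p} (hx : x ^ 4 = -7) (hu : u ^ 2 = 7)
    {d d' e₀ e'₀ : ℤ} (hee : e'₀ * e₀ = -28 * q ^ 2) (he'0 : ((e'₀ : ℤ) : ZMod p) ≠ 0)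
    (hns : ¬ IsSquare ((-2 : ZMod p) * (q : ZMod p) * ((e'₀ : ℤ) : ZMod p))) (hd : d = p * e₀) (hd' : d' = p * e'₀) :
    ¬ ((twoIsogenyQuartic (84 * ((q : ℤ) * p)) d d').map (Int.castRingHom ℚ_[p])).IsSoluble := by
  haveI : NeZero (2 : ZMod p) := ⟨fun h ↦ h448 (by rw [show (448 : ZMod p) = 2 * 224 by norm_num, h, zero_mul])⟩
  refine not_isSoluble_padic_of_prime_dvd_coeffs_of_roots (p := p) (c := 84 * q) (e := e₀) (e' := e'₀) (by ring) hd hd' he'0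
    (fun T hT ↦ ?_)
  exact not_isSquare_root_typeBeta_dual (qF := (q : ZMod p)) (e' := ((e'₀ : ℤ) : ZMod p)) (e := ((e₀ : ℤ) : ZMod p))
    (c := ((84 * q : ℤ) : ZMod p)) hx hu h448 he'0 (by push_cast; ring) (by rw [← Int.cast_mul, hee]; push_cast; ring) hns hT

/-- The family's arithmetic facts used by both halves of the count. [folklore] -/
private theorem dual_facts (hq4 : q % 4 = 3) (hq7 : jacobiSym q 7 = -1) (hp8 : p % 8 = 5) (hp7 : legendreSym p (-7) = 1)
    (hpq : jacobiSym p q = -1) :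
    (q ≠ p ∧ ¬ 7 ∣ q * p ∧ ¬ (7 : ℤ) ∣ q ∧ ¬ (7 : ℤ) ∣ p) ∧
    (legendreSym 7 q = -1 ∧ legendreSym 7 p = 1 ∧ ((q : ℤ) : ZMod 7) ≠ 0 ∧ ((p : ℤ) : ZMod 7) ≠ 0) ∧
    (legendreSym p 2 = -1 ∧ legendreSym p 7 = 1 ∧ legendreSym p (-1) = 1 ∧ legendreSym p q = -1) ∧
    (((q : ℤ) : ZMod p) ≠ 0 ∧ ((2 : ℤ) : ZMod p) ≠ 0 ∧ ((28 : ℤ) : ZMod p) ≠ 0 ∧ (448 : ZMod p) ≠ 0) := by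
  have hq : q.Prime := Fact.out
  have hp : p.Prime := Fact.out
  haveI : Fact (Nat.Prime 7) := ⟨by norm_num⟩
  have hq2 : q ≠ 2 := by rintro rfl; norm_num at hq4
  have hp2 : p ≠ 2 := by rintro rfl; norm_num at hp8
  have hqp : q ≠ p := by rintro rfl; omega
  have hq7' : q ≠ 7 := by rintro rfl; rw [jacobiSym.mod_left] at hq7; norm_num at hq7
  have hp7' : p ≠ 7 := by rintro rfl; norm_num at hp8
  have h7Q : ¬ (7 : ℤ) ∣ q := fun h ↦ hq7' ((Nat.prime_dvd_prime_iff_eq (by norm_num) hq).mp (by exact_mod_cast h)).symm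
  have h7P : ¬ (7 : ℤ) ∣ p := fun h ↦ hp7' ((Nat.prime_dvd_prime_iff_eq (by norm_num) hp).mp (by exact_mod_cast h)).symm
  have h7qp : ¬ 7 ∣ q * p := fun h ↦ ((Nat.Prime.dvd_mul (by norm_num)).mp h).elim (fun h ↦ h7Q (by exact_mod_cast h))
    (fun h ↦ h7P (by exact_mod_cast h))
  obtain ⟨h2p, h7p, hm1p⟩ := legendreSym_two_seven_neg_one_of_five_mod_eight hp8 hp7
  obtain ⟨hqp_p, -⟩ := legendreSym_swap_of_one_mod_four (q := q) (p := p) (by omega) hqp hq2 hpq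
  have h7_q : legendreSym 7 q = -1 := by rw [jacobiSym.legendreSym.to_jacobiSym]; exact_mod_cast hq7
  have h7_p : legendreSym 7 p = 1 := by
    rw [legendreSym.quadratic_reciprocity_one_mod_four (by omega : p % 4 = 1) (by norm_num : 7 ≠ 2)]; exact h7p
  have hq07 : ((q : ℤ) : ZMod 7) ≠ 0 := by rw [Ne, ZMod.intCast_zmod_eq_zero_iff_dvd]; exact_mod_cast h7Q
  have hp07 : ((p : ℤ) : ZMod 7) ≠ 0 := by rw [Ne, ZMod.intCast_zmod_eq_zero_iff_dvd]; exact_mod_cast h7P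
  have hqp0 : ((q : ℤ) : ZMod p) ≠ 0 :=
    intCast_ne_zero_of_not_dvd' (l := p) (fun h ↦ hqp ((Nat.prime_dvd_prime_iff_eq hp hq).mp h).symm)
  have hcp : ∀ a b : ℕ, (((2 ^ a * 7 ^ b : ℕ) : ℤ) : ZMod p) ≠ 0 := fun a b ↦
    intCast_ne_zero_of_not_dvd' (not_dvd_two_pow_mul_seven_pow' hp hp2 hp7' a b)
  have h2p0 : ((2 : ℤ) : ZMod p) ≠ 0 := by have := hcp 1 0; norm_num at this; exact_mod_cast this
  have h28p0 : ((28 : ℤ) : ZMod p) ≠ 0 := by have := hcp 2 1; norm_num at this; exact_mod_cast this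
  have h448p : (448 : ZMod p) ≠ 0 := by have := hcp 6 1; norm_num at this; exact_mod_cast this
  exact ⟨⟨hqp, h7qp, h7Q, h7P⟩, ⟨h7_q, h7_p, hq07, hp07⟩, ⟨h2p, h7p, hm1p, hqp_p⟩, ⟨hqp0, h2p0, h28p0, h448p⟩⟩

set_option maxHeartbeats 400000 in -- sixteen `p`-classes, four of them with a two-way cell split
/-- **§1. No class of `S′ = S(84qp, −28q²p²)` is divisible by `p`** (family C with `hcell`). [cite: SilvermanAEC2009, Prop. X.4.9 and Example X.4.10] -/
theorem not_prime_dvd_of_mem_twoIsogenySelmerGroup'_twoPrimesTwist (hq4 : q % 4 = 3) (hq7 : jacobiSym q 7 = -1) (hp8 : p % 8 = 5)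
    (hp7 : legendreSym p (-7) = 1) (hpq : jacobiSym p q = -1) (hcell : q % 8 = 7 ∨ ∃ x : ZMod p, x ^ 4 = -7)
    {d d' : ℤ} (hsqf : Squarefree d) (hdd' : -28 * ((q : ℤ) * p) ^ 2 = d * d')
    (hpadic : ∀ (l : ℕ) [Fact l.Prime], ((twoIsogenyQuartic (84 * ((q : ℤ) * p)) d d').map (Int.castRingHom ℚ_[l])).IsSoluble) :
    ¬ (p : ℤ) ∣ d := by
  have hq : q.Prime := Fact.out
  have hp : p.Prime := Fact.out
  haveI : Fact (Nat.Prime 7) := ⟨by norm_num⟩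
  have hqZ : Prime (q : ℤ) := Nat.prime_iff_prime_int.mp hq
  have hq0 : (q : ℤ) ≠ 0 := by exact_mod_cast hq.ne_zero
  have hp0 : (p : ℤ) ≠ 0 := by exact_mod_cast hp.ne_zero
  obtain ⟨⟨hqp, h7qp, h7Q, h7P⟩, ⟨h7_q, h7_p, hq07, hp07⟩, ⟨h2p, h7p, hm1p, hqp_p⟩, ⟨hqp0, h2p0, h28p0, h448p⟩⟩ :=
    dual_facts hq4 hq7 hp8 hp7 hpq
  have hns_2_p : ¬ IsSquare (((2 : ℤ)) : ZMod p) := (legendreSym.eq_neg_one_iff p).mp h2p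
  have hns_m14_p : ¬ IsSquare (((-14 : ℤ)) : ZMod p) :=
    (legendreSym.eq_neg_one_iff p).mp (by
      rw [show (-14 : ℤ) = -1 * (2 * 7) by norm_num, legendreSym.mul, legendreSym.mul, hm1p, h2p, h7p]; norm_num)
  have hns_7q_p : ¬ IsSquare (((7 * q : ℤ)) : ZMod p) :=
    (legendreSym.eq_neg_one_iff p).mp (by rw [legendreSym.mul, h7p, hqp_p]; norm_num)
  have hns_negq_p : ¬ IsSquare ((((q : ℤ) * -1 : ℤ)) : ZMod p) :=
    (legendreSym.eq_neg_one_iff p).mp (by rw [legendreSym.mul, hqp_p, hm1p]; norm_num)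
  have h2q0 : ((2 * q : ℤ) : ZMod p) ≠ 0 := by push_cast; exact mul_ne_zero (by exact_mod_cast h2p0) (by exact_mod_cast hqp0)
  -- `u² = 7` mod `p`
  obtain ⟨u, hu⟩ : ∃ u : ZMod p, u ^ 2 = 7 := by
    have h7p0 : ((7 : ℤ) : ZMod p) ≠ 0 := by
      intro h; apply h448p; rw [show (448 : ZMod p) = ((7 : ℤ) : ZMod p) * 64 by push_cast; norm_num, h, zero_mul]
    obtain ⟨u, hu⟩ := (legendreSym.eq_one_iff p h7p0).mp h7p
    exact ⟨u, by rw [sq, ← hu]; push_cast; ring⟩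
  rintro ⟨e, rfl⟩
  have hd'e : e * d' = -28 * (q : ℤ) ^ 2 * p := mul_left_cancel₀ hp0 (by linear_combination (-1 : ℤ) * hdd')
  have h0 : (p : ℤ) * e ∣ -28 * ((q : ℤ) * p) ^ 2 := ⟨d', hdd'⟩
  have h1 : (p : ℤ) * e ∣ (14 * ((q : ℤ) * p)) ^ 2 := h0.trans ⟨-7, by ring⟩
  have h14qp : (p : ℤ) * e ∣ 14 * ((q : ℤ) * p) := (hsqf.dvd_pow_iff_dvd (by norm_num)).mp h1
  have he14q : e ∣ 14 * (q : ℤ) := by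
    have : (p : ℤ) * e ∣ (p : ℤ) * (14 * q) := by rw [show (p : ℤ) * (14 * q) = 14 * (q * p) by ring]; exact h14qp
    exact (mul_dvd_mul_iff_left hp0).mp this
  by_cases hqe : (q : ℤ) ∣ e
  · obtain ⟨e₂, rfl⟩ := hqe
    have he14 : e₂ ∣ 14 := by
      have : (q : ℤ) * e₂ ∣ (q : ℤ) * 14 := by rw [mul_comm (q : ℤ) 14]; exact he14q
      exact (mul_dvd_mul_iff_left hq0).mp this
    have hd'e₂ : e₂ * d' = -28 * (q : ℤ) * p := mul_left_cancel₀ hq0 (by linear_combination hd'e)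
    have hele : e₂ ≤ 14 := Int.le_of_dvd (by norm_num) he14
    have hege : -14 ≤ e₂ := by have := Int.le_of_dvd (by norm_num) ((Int.neg_dvd).mpr he14); linarith
    -- at `7`: `qp`, `2qp` (test `d`), `−7qp`, `−14qp` (test `d′`)
    have hne1 : e₂ ≠ 1 := by
      rintro rfl; exact not_isSoluble_seven_dual h7qp hdd'.symm (not_seven_dvd_mul h7P (not_seven_dvd_mul h7Q (by decide)))
        (by rw [legendreSym.mul, legendreSym.mul, h7_p, h7_q]; norm_num) (hpadic 7)
    have hne2 : e₂ ≠ 2 := by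
      rintro rfl; exact not_isSoluble_seven_dual h7qp hdd'.symm (not_seven_dvd_mul h7P (not_seven_dvd_mul h7Q (by decide)))
        (by rw [legendreSym.mul, legendreSym.mul, h7_p, h7_q]; norm_num) (hpadic 7)
    have hnem7 : e₂ ≠ -7 := by
      rintro rfl
      have hd'1 : d' = 4 * ((q : ℤ) * p) := mul_left_cancel₀ (by norm_num : (-7 : ℤ) ≠ 0) (by linear_combination hd'e₂)
      refine not_isSoluble_seven_dual' h7qp hdd'.symm ?_ ?_ (hpadic 7)
      · rw [hd'1]; exact not_seven_dvd_mul (by decide) (not_seven_dvd_mul h7Q h7P)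
      · rw [hd'1, legendreSym.mul, legendreSym.mul, h7_q, h7_p]; norm_num
    have hnem14 : e₂ ≠ -14 := by
      rintro rfl
      have hd'1 : d' = 2 * ((q : ℤ) * p) := mul_left_cancel₀ (by norm_num : (-14 : ℤ) ≠ 0) (by linear_combination hd'e₂)
      refine not_isSoluble_seven_dual' h7qp hdd'.symm ?_ ?_ (hpadic 7)
      · rw [hd'1]; exact not_seven_dvd_mul (by decide) (not_seven_dvd_mul h7Q h7P)
      · rw [hd'1, legendreSym.mul, legendreSym.mul, h7_q, h7_p]; norm_num
    -- at `2`: `−2qp`, `14qp`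
    have hnem2 : e₂ ≠ -2 := by
      rintro rfl; exact not_isSoluble_two_dual_negTwoQP hq4 hp8 rfl (by ring)
        (mul_left_cancel₀ (by norm_num : (-2 : ℤ) ≠ 0) (by linear_combination hd'e₂)) (hpadic 2)
    have hne14 : e₂ ≠ 14 := by
      rintro rfl; exact not_isSoluble_two_dual_fourteenQP hq4 hp8 rfl (by ring)
        (mul_left_cancel₀ (by norm_num : (14 : ℤ) ≠ 0) (by linear_combination hd'e₂)) (hpadic 2)
    -- the split classes `−qp`, `7qp`
    have hnem1 : e₂ ≠ -1 := by
      rintro rfl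
      have hd'1 : d' = p * (28 * q) := mul_left_cancel₀ (by norm_num : (-1 : ℤ) ≠ 0) (by linear_combination hd'e₂)
      rcases hcell with hq8 | ⟨x, hx⟩
      · exact not_isSoluble_two_dual_negQP hq8 hp8 rfl (by ring) (by rw [hd'1]; ring) (hpadic 2)
      · refine not_isSoluble_padic_typeBeta_class_dual (q := q) h448p hx hu (e₀ := q * -1) (e'₀ := 28 * q) (by ring)
          (by push_cast; exact mul_ne_zero (by exact_mod_cast h28p0) (by exact_mod_cast hqp0)) ?_ (by ring) hd'1 (hpadic p)
        rw [show (-2 : ZMod p) * (q : ZMod p) * ((28 * q : ℤ) : ZMod p) = (((-14 * (2 * q) ^ 2 : ℤ)) : ZMod p) by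
          push_cast; ring]
        exact not_isSquare_mul_sq_zmod h2q0 hns_m14_p
    have hne7 : e₂ ≠ 7 := by
      rintro rfl
      have hd'1 : d' = p * (-4 * q) := mul_left_cancel₀ (by norm_num : (7 : ℤ) ≠ 0) (by linear_combination hd'e₂)
      rcases hcell with hq8 | ⟨x, hx⟩
      · exact not_isSoluble_two_dual_sevenQP hq8 hp8 rfl (by ring) (by rw [hd'1]; ring) (hpadic 2)
      · refine not_isSoluble_padic_typeBeta_class_dual (q := q) h448p hx hu (e₀ := q * 7) (e'₀ := -4 * q) (by ring)
          (by rw [show (-4 * q : ℤ) = -2 * (2 * q) by ring]; push_cast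
              exact mul_ne_zero (neg_ne_zero.mpr (by exact_mod_cast h2p0)) (by exact_mod_cast h2q0)) ?_ (by ring) hd'1 (hpadic p)
        rw [show (-2 : ZMod p) * (q : ZMod p) * ((-4 * q : ℤ) : ZMod p) = (((2 * (2 * q) ^ 2 : ℤ)) : ZMod p) by
          push_cast; ring]
        exact not_isSquare_mul_sq_zmod h2q0 hns_2_p
    obtain ⟨k, hk⟩ := he14
    interval_cases e₂ <;> omega
  · -- `q ∤ e`: `e ∣ 14`
    have hcop : IsCoprime e (q : ℤ) := ((hqZ.irreducible.coprime_iff_not_dvd).mpr hqe).symm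
    have he14 : e ∣ 14 := hcop.dvd_of_dvd_mul_left (by rw [mul_comm]; exact he14q)
    have hele : e ≤ 14 := Int.le_of_dvd (by norm_num) he14
    have hege : -14 ≤ e := by have := Int.le_of_dvd (by norm_num) ((Int.neg_dvd).mpr he14); linarith
    -- at `7`: `−p`, `−2p` (test `d`), `7p`, `14p` (test `d′`)
    have hnem1 : e ≠ -1 := by
      rintro rfl; exact not_isSoluble_seven_dual h7qp hdd'.symm (not_seven_dvd_mul h7P (by decide))
        (by rw [legendreSym.mul, h7_p]; norm_num) (hpadic 7)
    have hnem2 : e ≠ -2 := by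
      rintro rfl; exact not_isSoluble_seven_dual h7qp hdd'.symm (not_seven_dvd_mul h7P (by decide))
        (by rw [legendreSym.mul, h7_p]; norm_num) (hpadic 7)
    have hne7 : e ≠ 7 := by
      rintro rfl
      have hd'1 : d' = -4 * ((q : ℤ) ^ 2 * p) := mul_left_cancel₀ (by norm_num : (7 : ℤ) ≠ 0) (by linear_combination hd'e)
      refine not_isSoluble_seven_dual' h7qp hdd'.symm ?_ ?_ (hpadic 7)
      · rw [hd'1]; exact not_seven_dvd_mul (by decide) (not_seven_dvd_mul (by rw [sq]; exact not_seven_dvd_mul h7Q h7Q) h7P)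
      · rw [hd'1, legendreSym.mul, legendreSym.mul, legendreSym.sq_one' 7 hq07, h7_p]; norm_num
    have hne14 : e ≠ 14 := by
      rintro rfl
      have hd'1 : d' = -2 * ((q : ℤ) ^ 2 * p) := mul_left_cancel₀ (by norm_num : (14 : ℤ) ≠ 0) (by linear_combination hd'e)
      refine not_isSoluble_seven_dual' h7qp hdd'.symm ?_ ?_ (hpadic 7)
      · rw [hd'1]; exact not_seven_dvd_mul (by decide) (not_seven_dvd_mul (by rw [sq]; exact not_seven_dvd_mul h7Q h7Q) h7P)
      · rw [hd'1, legendreSym.mul, legendreSym.mul, legendreSym.sq_one' 7 hq07, h7_p]; norm_num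
    -- at `2`: `p`, `−7p`
    have hne1 : e ≠ 1 := by
      rintro rfl; exact not_isSoluble_two_dual_p hq4 hp8 rfl (by ring) (by linear_combination hd'e) (hpadic 2)
    have hnem7 : e ≠ -7 := by
      rintro rfl; exact not_isSoluble_two_dual_negSevenP hq4 hp8 rfl (by ring)
        (mul_left_cancel₀ (by norm_num : (-7 : ℤ) ≠ 0) (by linear_combination hd'e)) (hpadic 2)
    -- the split classes `2p`, `−14p`
    have hne2 : e ≠ 2 := by
      rintro rfl
      have hd'1 : d' = p * (-14 * q ^ 2) := mul_left_cancel₀ (by norm_num : (2 : ℤ) ≠ 0) (by linear_combination hd'e)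
      rcases hcell with hq8 | ⟨x, hx⟩
      · exact not_isSoluble_two_dual_twoP hq8 hp8 rfl (by ring) (by rw [hd'1]; ring) (hpadic 2)
      · refine not_isSoluble_padic_typeBeta_class_dual (q := q) h448p hx hu (e₀ := 2) (e'₀ := -14 * q ^ 2) (by ring)
          (by rw [show (-14 * q ^ 2 : ℤ) = -14 * q ^ 2 * 1 ^ 2 by ring]
              have h14 : ((-14 : ℤ) : ZMod p) ≠ 0 := fun h ↦ hns_m14_p (by rw [h]; exact IsSquare.zero)
              push_cast at h14 hqp0 ⊢
              exact mul_ne_zero (mul_ne_zero h14 (pow_ne_zero 2 hqp0)) (by norm_num)) ?_ (by ring) hd'1 (hpadic p)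
        rw [show (-2 : ZMod p) * (q : ZMod p) * ((-14 * q ^ 2 : ℤ) : ZMod p) = (((7 * q * (2 * q) ^ 2 : ℤ)) : ZMod p) by
          push_cast; ring]
        exact not_isSquare_mul_sq_zmod h2q0 hns_7q_p
    have hnem14 : e ≠ -14 := by
      rintro rfl
      have hd'1 : d' = p * (2 * q ^ 2) := mul_left_cancel₀ (by norm_num : (-14 : ℤ) ≠ 0) (by linear_combination hd'e)
      rcases hcell with hq8 | ⟨x, hx⟩
      · exact not_isSoluble_two_dual_negFourteenP hq8 hp8 rfl (by ring) (by rw [hd'1]; ring) (hpadic 2)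
      · refine not_isSoluble_padic_typeBeta_class_dual (q := q) h448p hx hu (e₀ := -14) (e'₀ := 2 * q ^ 2) (by ring)
          (by push_cast; exact mul_ne_zero (by exact_mod_cast h2p0) (pow_ne_zero 2 (by exact_mod_cast hqp0))) ?_ (by ring) hd'1
          (hpadic p)
        rw [show (-2 : ZMod p) * (q : ZMod p) * ((2 * q ^ 2 : ℤ) : ZMod p) = ((((q : ℤ) * -1 * (2 * q) ^ 2 : ℤ)) : ZMod p) by
          push_cast; ring]
        exact not_isSquare_mul_sq_zmod h2q0 hns_negq_p
    obtain ⟨k, hk⟩ := he14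
    interval_cases e <;> omega

set_option maxHeartbeats 400000 in -- sixteen classes prime to `p`
/-- **§2. `#S′ = #S(84qp, −28q²p²) ≤ 4`** on family C with `hcell`: `S′ ⊆ {1, −7, −2q, 14q}`.
[cite: SilvermanAEC2009, Prop. X.4.9 and Example X.4.10] [cite: Zywina2025, Lemma 3.1 (proof)] -/
theorem card_twoIsogenySelmerGroup'_twoPrimesTwist_le (hq4 : q % 4 = 3) (hq7 : jacobiSym q 7 = -1) (hp8 : p % 8 = 5)
    (hp7 : legendreSym p (-7) = 1) (hpq : jacobiSym p q = -1) (hcell : q % 8 = 7 ∨ ∃ x : ZMod p, x ^ 4 = -7) :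
    (twoIsogenySelmerGroup' (-42 * ((q : ℤ) * p)) (448 * ((q : ℤ) * p) ^ 2)).card ≤ 4 := by
  have hq : q.Prime := Fact.out
  have hp : p.Prime := Fact.out
  haveI : Fact (Nat.Prime 7) := ⟨by norm_num⟩
  have hqZ : Prime (q : ℤ) := Nat.prime_iff_prime_int.mp hq
  have hpZ : Prime (p : ℤ) := Nat.prime_iff_prime_int.mp hp
  have hq0 : (q : ℤ) ≠ 0 := by exact_mod_cast hq.ne_zero
  have hp0 : (p : ℤ) ≠ 0 := by exact_mod_cast hp.ne_zero
  obtain ⟨⟨hqp, h7qp, h7Q, h7P⟩, ⟨h7_q, h7_p, hq07, hp07⟩, ⟨h2p, h7p, hm1p, hqp_p⟩, ⟨hqp0, h2p0, h28p0, h448p⟩⟩ :=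
    dual_facts hq4 hq7 hp8 hp7 hpq
  have hns_2_p : ¬ IsSquare (((2 : ℤ)) : ZMod p) := (legendreSym.eq_neg_one_iff p).mp h2p
  have hns_m14_p : ¬ IsSquare (((-14 : ℤ)) : ZMod p) :=
    (legendreSym.eq_neg_one_iff p).mp (by
      rw [show (-14 : ℤ) = -1 * (2 * 7) by norm_num, legendreSym.mul, legendreSym.mul, hm1p, h2p, h7p]; norm_num)
  have hns_q7_p : ¬ IsSquare ((((q : ℤ) * 7 : ℤ)) : ZMod p) :=
    (legendreSym.eq_neg_one_iff p).mp (by rw [legendreSym.mul, h7p, hqp_p]; norm_num)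
  have hns_negq_p : ¬ IsSquare ((((q : ℤ) * -1 : ℤ)) : ZMod p) :=
    (legendreSym.eq_neg_one_iff p).mp (by rw [legendreSym.mul, hqp_p, hm1p]; norm_num)
  have hns_m14qq_p : ¬ IsSquare (((-14 * (q : ℤ) ^ 2 : ℤ)) : ZMod p) := not_isSquare_mul_sq_zmod hqp0 hns_m14_p
  have hns_2qq_p : ¬ IsSquare (((2 * (q : ℤ) ^ 2 : ℤ)) : ZMod p) := not_isSquare_mul_sq_zmod hqp0 hns_2_p
  have hns_28q_p : ¬ IsSquare (((28 * q : ℤ)) : ZMod p) := by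
    rw [show (28 * q : ℤ) = q * 7 * 2 ^ 2 by ring]; exact not_isSquare_mul_sq_zmod h2p0 hns_q7_p
  have hns_m4q_p : ¬ IsSquare (((-4 * q : ℤ)) : ZMod p) := by
    rw [show (-4 * q : ℤ) = q * -1 * 2 ^ 2 by ring]; exact not_isSquare_mul_sq_zmod h2p0 hns_negq_p
  have hA : (-2 * (-42 * ((q : ℤ) * p))) = 84 * ((q : ℤ) * p) := by ring
  have hB : ((-42 * ((q : ℤ) * p)) ^ 2 - 4 * (448 * ((q : ℤ) * p) ^ 2)) = -28 * ((q : ℤ) * p) ^ 2 := by ring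
  have hb : (-28 * ((q : ℤ) * p) ^ 2 : ℤ) ≠ 0 := mul_ne_zero (by norm_num) (pow_ne_zero 2 (mul_ne_zero hq0 hp0))
  have hsub : twoIsogenySelmerGroup' (-42 * ((q : ℤ) * p)) (448 * ((q : ℤ) * p) ^ 2) ⊆
      ({1, -7, (q : ℤ) * -2, (q : ℤ) * 14} : Finset ℤ) := by
    intro d hd
    rw [twoIsogenySelmerGroup'_eq, hA, hB, mem_twoIsogenySelmerGroup_iff hb] at hd
    obtain ⟨hsqf, ⟨d', hdd'⟩, hloc⟩ := hd
    have hd'eq : (-28 * ((q : ℤ) * p) ^ 2 : ℤ) / d = d' := by rw [hdd', Int.mul_ediv_cancel_left _ hsqf.ne_zero]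
    rw [hd'eq] at hloc
    obtain ⟨-, hpadic⟩ := hloc
    have hpd : ¬ (p : ℤ) ∣ d :=
      not_prime_dvd_of_mem_twoIsogenySelmerGroup'_twoPrimesTwist hq4 hq7 hp8 hp7 hpq hcell hsqf hdd' hpadic
    have h0 : d ∣ -28 * ((q : ℤ) * p) ^ 2 := ⟨d', hdd'⟩
    have h1 : d ∣ (14 * ((q : ℤ) * p)) ^ 2 := h0.trans ⟨-7, by ring⟩
    have h14qp : d ∣ 14 * ((q : ℤ) * p) := (hsqf.dvd_pow_iff_dvd (by norm_num)).mp h1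
    have hcopp : IsCoprime d (p : ℤ) := ((hpZ.irreducible.coprime_iff_not_dvd).mpr hpd).symm
    have h14q : d ∣ 14 * (q : ℤ) := hcopp.dvd_of_dvd_mul_right (by rw [show 14 * (q : ℤ) * p = 14 * (q * p) by ring]; exact h14qp)
    simp only [Finset.mem_insert, Finset.mem_singleton]
    by_cases hqd : (q : ℤ) ∣ d
    · obtain ⟨e, rfl⟩ := hqd
      have he14 : e ∣ 14 := by
        have : (q : ℤ) * e ∣ (q : ℤ) * 14 := by rw [mul_comm (q : ℤ) 14]; exact h14q
        exact (mul_dvd_mul_iff_left hq0).mp this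
      have hd'e : e * d' = -28 * (q : ℤ) * p ^ 2 := mul_left_cancel₀ hq0 (by linear_combination (-1 : ℤ) * hdd')
      have hele : e ≤ 14 := Int.le_of_dvd (by norm_num) he14
      have hege : -14 ≤ e := by have := Int.le_of_dvd (by norm_num) ((Int.neg_dvd).mpr he14); linarith
      -- at `7`: `q`, `2q` (test `d`), `−7q`, `−14q` (test `d′`)
      have hne1 : e ≠ 1 := by
        rintro rfl; exact not_isSoluble_seven_dual h7qp hdd'.symm (not_seven_dvd_mul h7Q (by decide))
          (by rw [legendreSym.mul, h7_q]; norm_num) (hpadic 7)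
      have hne2 : e ≠ 2 := by
        rintro rfl; exact not_isSoluble_seven_dual h7qp hdd'.symm (not_seven_dvd_mul h7Q (by decide))
          (by rw [legendreSym.mul, h7_q]; norm_num) (hpadic 7)
      have hnem7 : e ≠ -7 := by
        rintro rfl
        have hd'1 : d' = 4 * ((q : ℤ) * (p : ℤ) ^ 2) := mul_left_cancel₀ (by norm_num : (-7 : ℤ) ≠ 0) (by linear_combination hd'e)
        refine not_isSoluble_seven_dual' h7qp hdd'.symm ?_ ?_ (hpadic 7)
        · rw [hd'1]; exact not_seven_dvd_mul (by decide) (not_seven_dvd_mul h7Q (by rw [sq]; exact not_seven_dvd_mul h7P h7P))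
        · rw [hd'1, legendreSym.mul, legendreSym.mul, legendreSym.sq_one' 7 hp07, h7_q]; norm_num
      have hnem14 : e ≠ -14 := by
        rintro rfl
        have hd'1 : d' = 2 * ((q : ℤ) * (p : ℤ) ^ 2) := mul_left_cancel₀ (by norm_num : (-14 : ℤ) ≠ 0) (by linear_combination hd'e)
        refine not_isSoluble_seven_dual' h7qp hdd'.symm ?_ ?_ (hpadic 7)
        · rw [hd'1]; exact not_seven_dvd_mul (by decide) (not_seven_dvd_mul h7Q (by rw [sq]; exact not_seven_dvd_mul h7P h7P))
        · rw [hd'1, legendreSym.mul, legendreSym.mul, legendreSym.sq_one' 7 hp07, h7_q]; norm_num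
      -- at `p`: `−q`, `7q`
      have hnem1 : e ≠ -1 := by
        rintro rfl; exact not_isSoluble_padic_of_nonresidue_of_sq_dvd (p := p) (c := 84 * q) (e' := 28 * q) (by ring)
          (by linear_combination (-1 : ℤ) * hd'e) hns_negq_p hns_28q_p (hpadic p)
      have hne7 : e ≠ 7 := by
        rintro rfl; exact not_isSoluble_padic_of_nonresidue_of_sq_dvd (p := p) (c := 84 * q) (e' := -4 * q) (by ring)
          (mul_left_cancel₀ (by norm_num : (7 : ℤ) ≠ 0) (by linear_combination hd'e)) hns_q7_p hns_m4q_p (hpadic p)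
      obtain ⟨k, hk⟩ := he14
      interval_cases e <;> first | (exfalso; omega) | simp
    · have hcop : IsCoprime d (q : ℤ) := ((hqZ.irreducible.coprime_iff_not_dvd).mpr hqd).symm
      have hd14 : d ∣ 14 := hcop.dvd_of_dvd_mul_right h14q
      have hle : d ≤ 14 := Int.le_of_dvd (by norm_num) hd14
      have hge : -14 ≤ d := by have := Int.le_of_dvd (by norm_num) ((Int.neg_dvd).mpr hd14); linarith
      -- at `7`: `−1`, `−2` (test `d`), `7`, `14` (test `d′`)
      have hnm1 : d ≠ -1 := by
        rintro rfl; exact not_isSoluble_seven_dual h7qp hdd'.symm (by decide) (by norm_num) (hpadic 7)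
      have hnm2 : d ≠ -2 := by
        rintro rfl; exact not_isSoluble_seven_dual h7qp hdd'.symm (by decide) (by norm_num) (hpadic 7)
      have h7QP : ¬ (7 : ℤ) ∣ ((q : ℤ) * p) ^ 2 := by
        rw [sq]; exact not_seven_dvd_mul (not_seven_dvd_mul h7Q h7P) (not_seven_dvd_mul h7Q h7P)
      have hQP07 : ((((q : ℤ) * p : ℤ)) : ZMod 7) ≠ 0 := by push_cast at hq07 hp07 ⊢; exact mul_ne_zero hq07 hp07
      have hn7 : d ≠ 7 := by
        rintro rfl
        have hd'1 : d' = -4 * ((q : ℤ) * p) ^ 2 := by linarith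
        refine not_isSoluble_seven_dual' h7qp hdd'.symm ?_ ?_ (hpadic 7)
        · rw [hd'1]; exact not_seven_dvd_mul (by decide) h7QP
        · rw [hd'1, legendreSym.mul, legendreSym.sq_one' 7 hQP07]; norm_num
      have hn14 : d ≠ 14 := by
        rintro rfl
        have hd'1 : d' = -2 * ((q : ℤ) * p) ^ 2 := by linarith
        refine not_isSoluble_seven_dual' h7qp hdd'.symm ?_ ?_ (hpadic 7)
        · rw [hd'1]; exact not_seven_dvd_mul (by decide) h7QP
        · rw [hd'1, legendreSym.mul, legendreSym.sq_one' 7 hQP07]; norm_num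
      -- at `p`: `2`, `−14`
      have hn2 : d ≠ 2 := by
        rintro rfl; exact not_isSoluble_padic_of_nonresidue_of_sq_dvd (p := p) (c := 84 * q) (e' := -14 * q ^ 2) (by ring)
          (by linarith) hns_2_p hns_m14qq_p (hpadic p)
      have hnm14 : d ≠ -14 := by
        rintro rfl; exact not_isSoluble_padic_of_nonresidue_of_sq_dvd (p := p) (c := 84 * q) (e' := 2 * q ^ 2) (by ring)
          (by linarith) hns_m14_p hns_2qq_p (hpadic p)
      obtain ⟨k, hk⟩ := hd14
      interval_cases d <;> first | (exfalso; omega) | simp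
  exact (Finset.card_le_card hsub).trans Finset.card_le_four

end SelmerDual

end Summit.BirchSwinnertonDyer.BirchSwinnertonDyer.Theorems.GoldfeldGoodTwists

end
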